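import Mathlib.Analysis.Fourier.AddCircleMulti
import Literature.Analysis.FunctionSpaces.FlatTorus
import Mathlib.Analysis.SpecialFunctions.Pow.Integral
import Mathlib.Analysis.SpecialFunctions.Trigonometric.Bounds
import Mathlib.Analysis.Complex.Trigonometric
import HarnessLib

/-!
# The lattice dispersion `μ(θ) = ∑ᵢ |e^{2πiθᵢ} - 1|²` on the torus and the integrability of `1/μ`
in dimension `≥ 3`

Analysis/FunctionSpaces support file for the lattice potential theory of `ℤ^d` (Fourier symbol of
the lattice Laplacian: `-Δ` on `ℓ²(ℤ^d)` is unitarily equivalent, via the Fourier series of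
`UnitAddTorus d`, to multiplication by `μ(θ) = ∑ᵢ |e^{2πiθᵢ} - 1|² = ∑ᵢ 4 sin²(πθᵢ)`), used in the
proof programme of the named fact
`Literature.MathematicalPhysics.QuantumFieldTheory.FrohlichSpencerU1PerimeterLawD4` for the
Coulomb-energy bound `(ε_Λ, ε_Λ) ≤ const (L+T)` (Fröhlich–Spencer 1982 (2.88)): the finiteness
of the lattice Green's function at coinciding points in `d ≥ 3`,
`G(0) = ∫_{T^d} dθ/μ(θ) < ∞`. Everything is proved; no named fact is introduced.

* `latticeDispersion θ = ∑ᵢ ‖𝐞(θᵢ) - 1‖²` (`𝐞 = fourier 1`), non-negative and continuous;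
  on representatives `latticeDispersion (x mod 1) = ∑ᵢ 4 sin²(π xᵢ)` (`latticeDispersion_coe`);
* `sixteen_mul_sq_le_four_mul_sin_sq` (Jordan's inequality: `16 t² ≤ 4 sin²(πt)` for `|t| ≤ ½`) and
  `norm_sq_le_latticeDispersion` (`16 ‖x‖² ≤ μ(x)` on the fundamental cube, sup norm);
* `integrable_inv_latticeDispersion` (**`1/μ ∈ L¹(T^d)` for `3 ≤ d`**): on the fundamental cube
  `(-½, ½]^d`, `1/μ ≤ (1/16) ‖x‖^{-2}` with `2 < d` (Mathlib's `integrableOn_ball_of_norm_le_rpow`),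
  transported to the torus by `UnitAddTorus.lintegral_preimage`; `integrable_inv_add_latticeDispersion`
  (`1/(a + μ)` for `a ≥ 0`).

## References

* J. Fröhlich, T. Spencer, Comm. Math. Phys. 83 (1982) 411–454, §2.5 (the lattice Green's function
  `(-Δ_Λ)⁻¹`), §2.10 (2.88). [FrohlichSpencerCMP1982]
-/

noncomputable section

open MeasureTheory Set Filter Complex
open scoped Real ENNReal

namespace Literature.Analysis.FunctionSpaces

namespace LatticeFourier

variable {ι : Type*} [Fintype ι]

/-! ### The dispersion -/

/-- **The lattice dispersion** `μ(θ) = ∑ᵢ ‖𝐞(θᵢ) - 1‖²`, `𝐞(t) = e^{2πit}`: the Fourier symbol of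
the lattice Laplacian `-Δ` of `ℤ^ι` on the dual torus `UnitAddTorus ι`. [folklore] -/
def latticeDispersion (θ : UnitAddTorus ι) : ℝ := ∑ i, ‖(fourier 1 (θ i) : ℂ) - 1‖ ^ 2

/-- `μ ≥ 0`. [folklore] -/
theorem latticeDispersion_nonneg (θ : UnitAddTorus ι) : 0 ≤ latticeDispersion θ :=
  Finset.sum_nonneg fun _ _ => sq_nonneg _

/-- `μ` is continuous. [folklore] -/
theorem continuous_latticeDispersion : Continuous (latticeDispersion (ι := ι)) := by
  unfold latticeDispersion
  refine continuous_finsetSum _ fun i _ => ?_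
  exact ((continuous_norm.comp (((fourier 1).continuous.comp (continuous_apply i)).sub
    continuous_const)).pow 2)

/-- The character on a representative: `𝐞(t mod 1) = exp(I · 2πt)`. [folklore] -/
theorem fourier_one_coe (t : ℝ) :
    (fourier 1 ((t : ℝ) : UnitAddCircle) : ℂ) = Complex.exp (Complex.I * ((2 * π * t : ℝ) : ℂ)) := by
  rw [fourier_coe_apply]
  congr 1
  push_cast
  ring

/-- `‖𝐞(t) - 1‖² = 4 sin²(πt)`. [folklore] -/
theorem norm_fourier_one_sub_one_sq (t : ℝ) :
    ‖(fourier 1 ((t : ℝ) : UnitAddCircle) : ℂ) - 1‖ ^ 2 = 4 * Real.sin (π * t) ^ 2 := by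
  rw [fourier_one_coe, Complex.norm_exp_I_mul_ofReal_sub_one, Real.norm_eq_abs, sq_abs]
  have : 2 * π * t / 2 = π * t := by ring
  rw [this]
  ring

/-- On representatives, `μ(x mod 1) = ∑ᵢ 4 sin²(π xᵢ)`. [folklore] -/
theorem latticeDispersion_coe (x : ι → ℝ) :
    latticeDispersion (fun i => ((x i : ℝ) : UnitAddCircle)) = ∑ i, 4 * Real.sin (π * x i) ^ 2 := by
  simp only [latticeDispersion, norm_fourier_one_sub_one_sq]

/-! ### Jordan's inequality on the fundamental cube -/

/-- `16 t² ≤ 4 sin²(πt)` for `|t| ≤ ½` (Jordan's inequality `sin u ≥ (2/π) u` on `[0, π/2]`). [folklore] -/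
theorem sixteen_mul_sq_le_four_mul_sin_sq {t : ℝ} (ht : |t| ≤ 1 / 2) :
    16 * t ^ 2 ≤ 4 * Real.sin (π * t) ^ 2 := by
  -- Jordan: `2|t| ≤ sin(π|t|)`
  have h0 : 0 ≤ π * |t| := by positivity
  have h1 : π * |t| ≤ π / 2 := by
    have := mul_le_mul_of_nonneg_left ht Real.pi_pos.le
    linarith
  have hj := Real.mul_le_sin h0 h1
  have h2 : 2 / π * (π * |t|) = 2 * |t| := by field_simp
  rw [h2] at hj
  -- square and use evenness of `sin²`
  have hsq : Real.sin (π * |t|) ^ 2 = Real.sin (π * t) ^ 2 := by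
    rcases abs_choice t with h | h <;> rw [h]
    rw [mul_neg, Real.sin_neg, neg_sq]
  have h3 : (2 * |t|) ^ 2 ≤ Real.sin (π * |t|) ^ 2 := pow_le_pow_left₀ (by positivity) hj 2
  rw [hsq, mul_pow, sq_abs] at h3
  linarith

/-- **`16 ‖x‖² ≤ μ(x)` on the fundamental cube** (`|xᵢ| ≤ ½` for all `i`; sup norm). [folklore] -/
theorem norm_sq_le_latticeDispersion {x : ι → ℝ} (hx : ∀ i, |x i| ≤ 1 / 2) :
    16 * ‖x‖ ^ 2 ≤ latticeDispersion (fun i => ((x i : ℝ) : UnitAddCircle)) := by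
  rw [latticeDispersion_coe]
  rcases isEmpty_or_nonempty ι with hι | hι
  · simp [Pi.norm_def]
  -- the sup norm is attained at some coordinate
  obtain ⟨i, hi⟩ : ∃ i, ‖x‖ = |x i| := by
    obtain ⟨i, -, hi⟩ := Finset.exists_mem_eq_sup' Finset.univ_nonempty fun j => ‖x j‖₊
    refine ⟨i, ?_⟩
    rw [Pi.norm_def]
    change ((Finset.univ.sup fun j => ‖x j‖₊ : NNReal) : ℝ) = |x i|
    rw [Finset.sup'_eq_sup] at hi
    rw [hi]
    rfl
  calc 16 * ‖x‖ ^ 2 = 16 * (x i) ^ 2 := by rw [hi, sq_abs]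
    _ ≤ 4 * Real.sin (π * x i) ^ 2 := sixteen_mul_sq_le_four_mul_sin_sq (hx i)
    _ ≤ ∑ j, 4 * Real.sin (π * x j) ^ 2 :=
        Finset.single_le_sum (f := fun j => 4 * Real.sin (π * x j) ^ 2) (fun j _ => by positivity)
          (Finset.mem_univ i)

/-! ### Integrability of `1/μ` in dimension `≥ 3` -/

/-- On the fundamental cube, `1/μ(x) ≤ (1/16) ‖x‖^{-2}`. [folklore] -/
theorem inv_latticeDispersion_le {x : ι → ℝ} (hx : ∀ i, |x i| ≤ 1 / 2) :
    (latticeDispersion (fun i => ((x i : ℝ) : UnitAddCircle)))⁻¹ ≤ (1 / 16) * ‖x‖ ^ (-2 : ℝ) := by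
  by_cases h0 : x = 0
  · subst h0
    have : latticeDispersion (fun i : ι => (((0 : ι → ℝ) i : ℝ) : UnitAddCircle)) = 0 := by
      rw [latticeDispersion_coe]; simp
    rw [this, inv_zero, norm_zero, Real.zero_rpow (by norm_num)]
    norm_num
  · have hpos : 0 < ‖x‖ := norm_pos_iff.2 h0
    have hle := norm_sq_le_latticeDispersion hx
    have hμpos : 0 < latticeDispersion (fun i => ((x i : ℝ) : UnitAddCircle)) :=
      lt_of_lt_of_le (by positivity) hle
    rw [Real.rpow_neg hpos.le, show (2 : ℝ) = ((2 : ℕ) : ℝ) by norm_num, Real.rpow_natCast,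
      ← div_eq_mul_inv, le_div_iff₀ (by positivity), ← one_div, div_mul_eq_mul_div, one_mul,
      div_le_iff₀ hμpos]
    linarith

/-- The fundamental cube `(-½, ½]^ι` lies in the open unit ball of the sup norm. [folklore] -/
theorem cube_subset_ball :
    {x : ι → ℝ | ∀ i, x i ∈ Ioc (-(1 / 2 : ℝ)) (-(1 / 2) + 1)} ⊆ Metric.ball 0 1 := by
  intro x hx
  rw [Metric.mem_ball, dist_zero_right]
  refine lt_of_le_of_lt ?_ (show (1 / 2 : ℝ) < 1 by norm_num)
  refine (pi_norm_le_iff_of_nonneg (by norm_num)).2 fun i => ?_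
  have := hx i
  rw [Real.norm_eq_abs, abs_le]
  constructor <;> linarith [this.1, this.2]

omit [Fintype ι] in
/-- On the fundamental cube all coordinates are at most `½` in absolute value. [folklore] -/
theorem abs_le_of_mem_cube {x : ι → ℝ} (hx : ∀ i, x i ∈ Ioc (-(1 / 2 : ℝ)) (-(1 / 2) + 1)) (i : ι) :
    |x i| ≤ 1 / 2 := by
  have := hx i
  rw [abs_le]
  constructor <;> linarith [this.1, this.2]

/-- **`1/μ` is integrable on the torus in dimension `≥ 3`**: the lattice Green's function of
`ℤ^d`, `d ≥ 3`, is finite at coinciding points, `G(0) = ∫_{T^d} dθ/μ(θ) < ∞`. [folklore] -/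
theorem integrable_inv_latticeDispersion (hd : 3 ≤ Fintype.card ι) :
    Integrable (fun θ : UnitAddTorus ι => (latticeDispersion θ)⁻¹) := by
  -- measurability
  have hmeas : AEStronglyMeasurable (fun θ : UnitAddTorus ι => (latticeDispersion θ)⁻¹) volume :=
    (continuous_latticeDispersion.measurable.inv).aestronglyMeasurable
  refine ⟨hmeas, ?_⟩
  -- on the cube the integrand is dominated by `(1/16)‖x‖^{-2}`, integrable on the unit ball
  set cube : Set (ι → ℝ) := {x | ∀ i, x i ∈ Ioc (-(1 / 2 : ℝ)) (-(1 / 2) + 1)} with hcube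
  have hcm : MeasurableSet cube := MeasurableSet.univ_pi' fun i => measurableSet_Ioc
  set g : (ι → ℝ) → ℝ := cube.indicator fun x =>
    (latticeDispersion (fun i => ((x i : ℝ) : UnitAddCircle)))⁻¹ with hg
  have hgm : AEStronglyMeasurable g volume := by
    refine (Measurable.indicator ?_ hcm).aestronglyMeasurable
    exact (continuous_latticeDispersion.comp (continuous_pi fun i =>
      (AddCircle.continuous_mk' 1).comp (continuous_apply i))).measurable.inv
  have hdim : (2 : ℝ) < Module.finrank ℝ (ι → ℝ) := by
    rw [Module.finrank_pi]
    exact_mod_cast (lt_of_lt_of_le (by norm_num) hd)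
  have hdim1 : 1 ≤ Module.finrank ℝ (ι → ℝ) := by
    rw [Module.finrank_pi]; omega
  have hint : IntegrableOn g (Metric.ball (0 : ι → ℝ) 1) volume := by
    refine integrableOn_ball_of_norm_le_rpow hdim1 (C := 1 / 16) hdim (ae_of_all _ fun x => ?_) hgm
    rw [hg]
    by_cases hx : x ∈ cube
    · rw [indicator_of_mem hx, Real.norm_eq_abs, abs_of_nonneg (inv_nonneg.2 (latticeDispersion_nonneg _))]
      exact inv_latticeDispersion_le (abs_le_of_mem_cube hx)
    · rw [indicator_of_notMem hx, norm_zero]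
      positivity
  have hint' : IntegrableOn g cube volume := hint.mono_set cube_subset_ball
  have hfin : ∫⁻ x in cube, ‖g x‖ₑ < ∞ := hint'.2
  -- the integral over the torus is the integral over the fundamental cube
  have htrans := UnitAddTorus.lintegral_preimage
    (fun θ : UnitAddTorus ι => ‖(latticeDispersion θ)⁻¹‖ₑ) (fun _ : ι => -(1 / 2 : ℝ))
  have hcongr : ∫⁻ x in cube, ‖(latticeDispersion (fun i => ((x i : ℝ) : UnitAddCircle)))⁻¹‖ₑ =
      ∫⁻ x in cube, ‖g x‖ₑ :=
    setLIntegral_congr_fun hcm fun x hx => by rw [hg, indicator_of_mem hx]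
  -- H21's global `volume` on the torus is Mathlib's local Haar volume (`Torus.volume_eq_pi_haarAddCircle`)
  unfold HasFiniteIntegral
  rw [Torus.volume_eq_pi_haarAddCircle]
  exact lt_of_eq_of_lt (htrans.trans hcongr) hfin

/-- `1/(a + μ)` is integrable on the torus in dimension `≥ 3` for `a ≥ 0` (for `a > 0` it is even
bounded). [folklore] -/
theorem integrable_inv_add_latticeDispersion (hd : 3 ≤ Fintype.card ι) {a : ℝ} (ha : 0 ≤ a) :
    Integrable (fun θ : UnitAddTorus ι => (a + latticeDispersion θ)⁻¹) := by
  rcases ha.eq_or_lt with rfl | ha'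
  · simpa only [zero_add] using integrable_inv_latticeDispersion hd
  · refine (integrable_const a⁻¹).mono' ?_ (ae_of_all _ fun θ => ?_)
    · exact ((continuous_const.add continuous_latticeDispersion).measurable.inv).aestronglyMeasurable
    · rw [Real.norm_eq_abs, abs_of_nonneg (inv_nonneg.2 (add_nonneg ha (latticeDispersion_nonneg _)))]
      exact inv_anti₀ ha' (le_add_of_nonneg_right (latticeDispersion_nonneg θ))

end LatticeFourier

end Literature.Analysis.FunctionSpaces
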